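import Mathlib
import HarnessLib
import Summits.NavierStokesRegularity.NavierStokesRegularity.Theorems.TypeIQuarterGateScarEnvelopeTypeIForcedTsaiExactSwirlTail

/-!
# ARM B — DATUM B-2m FACT 1 (even-`J` elementary case), kernel part (K2): the swirl field
  `U(y) = (|y|⁻³ + 6|y|⁻⁵) · (y × ∇P₂(y))` is an EXACT zero mode of the linearised Leray profile
  operator on `ℝ³ ∖ {0}` (ns-wall-extremal, eng-1 lineage g6, 2026-08-29)

WHAT IS PROVED (theorem-only; explicit fields; standard axioms).  Fix `a b : ℝ³` and the harmonic
quadratic `P₂(y) = ⟪a,y⟫⟪b,y⟫` (its trace part `⟪a,b⟫|y|²/3` is invisible below since `y × y = 0`),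
`∇P₂(y) = ⟪b,y⟫a + ⟪a,y⟫b`, and the degree-2 TOROIDAL harmonic field
`Φ(y) := y × ∇P₂(y) = ⟪b,y⟫(y × a) + ⟪a,y⟫(y × b)`.  With the radial profile
`χ(σ) = σ^{−3/2} + 6σ^{−5/2}` (`σ = |y|²`, i.e. `χ = r⁻³ + 6r⁻⁵ = r^{−J−1}(1 + J(J+1)r⁻²)` at `J = 2`)
put `U(y) := χ(‖y‖²) • Φ(y)`.  For `x ≠ 0`:
* `toroidalHarmonic_homogeneous`, `fderiv_toroidalHarmonic_apply_self` : `Φ(t•y) = t²Φ(y)`,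
  `DΦ(x)[x] = 2Φ(x)`; `laplacian_toroidalHarmonic` : `ΔΦ = 0`; `divergence_toroidalHarmonic` :
  `div Φ = 0`; `inner_self_toroidalHarmonic` : `⟪x, Φ(x)⟫ = 0`;
* `laplacian_swirlZeroModeJ2` : `ΔU(x) = −6(‖x‖²)^{−5/2} Φ(x)` (so `−Δ` of the Type-I part
  `|y|⁻³Φ` is exactly the companion `6|y|⁻⁵Φ`, and the companion itself is HARMONIC — the Kelvin
  transform of `Φ`);
* `fderiv_swirlZeroModeJ2_apply_self` : `DU(x)[x] = −((‖x‖²)^{−3/2} + 18(‖x‖²)^{−5/2}) Φ(x)`;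
* ★★ `swirlZeroModeJ2_linearisedLerayProfile` :
  `−ΔU(x) + ½U(x) + ½DU(x)[x] = 0` — the profile equation of `IsLerayProfile 1 ½` (NRŠ (1.4))
  WITHOUT pressure and WITHOUT the convective term holds EXACTLY off the origin;
* `divergence_swirlZeroModeJ2_eq_zero` : `div U = 0` off the origin.

MEANING (HOME/ARM-B/swirltail-eng1g6/B2J-CORRECTION.md §0 (a); DATUM B-2m FACT 1 of
ns-wall-eng-2 g2, confirmed by ns-wall-crit-1 g4 04:23:48Z (i)).  Swirl sectors DO carry exact
zero-residual decaying exteriors with the Type-I rate `|U| ~ |y|⁻¹` once the `|y|⁻³` companion is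
added (`J(J+1) = 6` here); for even `J` the decaying Kummer branch `U((J+1)/2, J+3/2, r²/4)`
terminates and the mode is elementary — this file is the `J = 2` instance.  Contrast K1a/K1b
(`…ExactSwirlTail[Obstruction]`): the EXACTLY homogeneous swirl tail is not a zero mode.  (The
decaying `J = 1` mode `2e^{r²/4}r⁻³Γ(3/2, r²/4)·(y×e)` is not elementary and is not formalised.)
HONEST FRAME: pointwise identities for explicit fields on `ℝ³ ∖ {0}` (singular at the origin like
the Stokeslet); LINEAR order only (the convective term of `U` is `O(amplitude²)` and not zero);
nothing about the wall H3, crux `ScarEnvelopeTypeI` (stmt-23843, OPEN) or Navier–Stokes regularity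
(NOT proved).
-/

noncomputable section

set_option linter.dupNamespace false

namespace Summit.NavierStokesRegularity.NavierStokesRegularity.Cruxes.ScarEnvelopeTypeI.ForcedTsai

namespace SwirlTail

open scoped Laplacian RealInnerProductSpace InnerProductSpace
open Literature.Analysis.FluidPDE Literature.Analysis.PDE Set Filter Topology

/-! ## The degree-2 toroidal harmonic `Φ(y) = ⟪b,y⟫(y × a) + ⟪a,y⟫(y × b)` -/

/-- A real-valued continuous linear functional is harmonic: `Δℓ = 0`. -/
theorem laplacian_clm_real (ℓ : E3 →L[ℝ] ℝ) (x : E3) : (Δ (fun y : E3 => ℓ y)) x = 0 := by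
  have h1 : fderiv ℝ (fun y : E3 => ℓ y) = fun _ => ℓ := by
    funext y
    exact ℓ.fderiv
  rw [InnerProductSpace.laplacian_eq_iteratedFDeriv_orthonormalBasis _
    (EuclideanSpace.basisFun (Fin 3) ℝ)]
  refine Finset.sum_eq_zero fun j _ => ?_
  rw [iteratedFDeriv_two_apply, h1, fderiv_fun_const]
  rfl

/-- `Δ(⟪b,y⟫ • (y × a)) = 2 (b × a)`: Leibniz rule with both factors linear. -/
theorem laplacian_inner_smul_cross (a b x : E3) :
    (Δ (fun y : E3 => ⟪b, y⟫ • cross y a)) x = (2 : ℝ) • cross b a := by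
  set B := EuclideanSpace.basisFun (Fin 3) ℝ with hB
  have hψ : ContDiffAt ℝ 2 (fun y : E3 => ⟪b, y⟫) x := (innerSL ℝ b).contDiff.contDiffAt
  have hV : ContDiffAt ℝ 2 (fun y : E3 => cross y a) x := by
    rw [cross_const_eq_flip]; exact (crossCLM.flip a).contDiff.contDiffAt
  rw [LoewnerNirenberg.laplacian_smul_apply hψ hV B]
  have hΔψ : (Δ (fun y : E3 => ⟪b, y⟫)) x = 0 := laplacian_clm_real (innerSL ℝ b) x
  have hΔV : (Δ (fun y : E3 => cross y a)) x = 0 := by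
    rw [cross_const_eq_flip]; exact laplacian_clm (crossCLM.flip a) x
  have hdψ : ∀ i, fderiv ℝ (fun y : E3 => ⟪b, y⟫) x (B i) = ⟪b, B i⟫ := fun i => by
    rw [show (fun y : E3 => ⟪b, y⟫) = ⇑(innerSL ℝ b) from rfl, (innerSL ℝ b).fderiv]; rfl
  have hdV : ∀ i, fderiv ℝ (fun y : E3 => cross y a) x (B i) = cross (B i) a := fun i => by
    rw [cross_const_eq_flip, show (fun y : E3 => (crossCLM.flip a) y) = ⇑(crossCLM.flip a) from rfl,
      (crossCLM.flip a).fderiv]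
    simp
  rw [hΔψ, hΔV, zero_smul, zero_add, smul_zero, add_zero]
  congr 1
  calc ∑ i, (fderiv ℝ (fun y : E3 => ⟪b, y⟫) x (B i)) • fderiv ℝ (fun y : E3 => cross y a) x (B i)
      = ∑ i, ⟪b, B i⟫ • cross (B i) a := Finset.sum_congr rfl fun i _ => by rw [hdψ, hdV]
    _ = cross b a := sum_inner_smul_cross B b a

/-- **`Φ` is harmonic**: `Δ[⟪b,y⟫(y × a) + ⟪a,y⟫(y × b)] = 2(b × a) + 2(a × b) = 0`. -/
theorem laplacian_toroidalHarmonic (a b x : E3) :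
    (Δ (fun y : E3 => ⟪b, y⟫ • cross y a + ⟪a, y⟫ • cross y b)) x = 0 := by
  have hA : ContDiffAt ℝ 2 (fun y : E3 => ⟪b, y⟫ • cross y a) x := by
    refine (innerSL ℝ b).contDiff.contDiffAt.smul ?_
    rw [cross_const_eq_flip]; exact (crossCLM.flip a).contDiff.contDiffAt
  have hB : ContDiffAt ℝ 2 (fun y : E3 => ⟪a, y⟫ • cross y b) x := by
    refine (innerSL ℝ a).contDiff.contDiffAt.smul ?_
    rw [cross_const_eq_flip]; exact (crossCLM.flip b).contDiff.contDiffAt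
  rw [show (fun y : E3 => ⟪b, y⟫ • cross y a + ⟪a, y⟫ • cross y b)
      = (fun y : E3 => ⟪b, y⟫ • cross y a) + fun y : E3 => ⟪a, y⟫ • cross y b from rfl,
    hA.laplacian_add hB, laplacian_inner_smul_cross, laplacian_inner_smul_cross, cross_swap a b,
    smul_neg, add_neg_cancel]

/-- `Φ` is `C^∞` (a polynomial field). -/
theorem contDiff_toroidalHarmonic (a b : E3) {n : WithTop ℕ∞} :
    ContDiff ℝ n (fun y : E3 => ⟪b, y⟫ • cross y a + ⟪a, y⟫ • cross y b) := by
  have h1 : ContDiff ℝ n (fun y : E3 => cross y a) := by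
    rw [cross_const_eq_flip]; exact (crossCLM.flip a).contDiff
  have h2 : ContDiff ℝ n (fun y : E3 => cross y b) := by
    rw [cross_const_eq_flip]; exact (crossCLM.flip b).contDiff
  exact ((innerSL ℝ b).contDiff.smul h1).add ((innerSL ℝ a).contDiff.smul h2)

/-- **Degree-2 homogeneity** of `Φ`: `Φ(t•y) = t² Φ(y)`. -/
theorem toroidalHarmonic_homogeneous (a b y : E3) (t : ℝ) :
    ⟪b, t • y⟫ • cross (t • y) a + ⟪a, t • y⟫ • cross (t • y) b
      = (t ^ (2 : ℤ)) • (⟪b, y⟫ • cross y a + ⟪a, y⟫ • cross y b) := by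
  have hc : ∀ v : E3, cross (t • y) v = t • cross y v := fun v => by
    rw [← crossCLM_apply, map_smul, smul_apply, crossCLM_apply]
  rw [hc, hc, inner_smul_right, inner_smul_right, zpow_two, smul_add, smul_smul, smul_smul, smul_smul,
    smul_smul]
  congr 1 <;> (congr 1; ring)

/-- **Euler's identity for `Φ`**: `DΦ(x)[x] = 2 Φ(x)`. -/
theorem fderiv_toroidalHarmonic_apply_self (a b x : E3) :
    fderiv ℝ (fun y : E3 => ⟪b, y⟫ • cross y a + ⟪a, y⟫ • cross y b) x x
      = (2 : ℝ) • (⟪b, x⟫ • cross x a + ⟪a, x⟫ • cross x b) := by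
  have h := fderiv_apply_self_of_homogeneous
    (U := fun y : E3 => ⟪b, y⟫ • cross y a + ⟪a, y⟫ • cross y b) (y := x) 2
    (fun t _ => toroidalHarmonic_homogeneous a b x t)
    ((contDiff_toroidalHarmonic a b (n := 1)).differentiable one_ne_zero).differentiableAt
  simpa using h

/-- `Φ` is tangent to spheres: `⟪x, Φ(x)⟫ = 0`. -/
theorem inner_self_toroidalHarmonic (a b x : E3) :
    ⟪x, ⟪b, x⟫ • cross x a + ⟪a, x⟫ • cross x b⟫ = 0 := by
  rw [inner_add_right, inner_self_smul_cross, inner_self_smul_cross, add_zero]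

/-- Antisymmetry of the scalar triple product in the outer slots: `⟪a, x × b⟫ = −⟪b, x × a⟫`. -/
theorem inner_cross_middle_antisymm (a b x : E3) : ⟪a, cross x b⟫ = -⟪b, cross x a⟫ := by
  have hI : ∀ u v : E3, ⟪u, v⟫ = u 0 * v 0 + u 1 * v 1 + u 2 * v 2 := fun u v => by
    simp [EuclideanSpace.inner_eq_star_dotProduct, dotProduct, Fin.sum_univ_three, mul_comm]
  rw [hI, hI]
  simp [cross, cross_apply]
  ring

/-- The derivative of `Φ` as an explicit continuous linear map. -/
theorem hasFDerivAt_toroidalHarmonic (a b x : E3) :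
    HasFDerivAt (fun y : E3 => ⟪b, y⟫ • cross y a + ⟪a, y⟫ • cross y b)
      ((⟪b, x⟫ • crossCLM.flip a + (innerSL ℝ b).smulRight (cross x a))
        + (⟪a, x⟫ • crossCLM.flip b + (innerSL ℝ a).smulRight (cross x b))) x := by
  have hca : HasFDerivAt (fun y : E3 => cross y a) (crossCLM.flip a) x := by
    rw [cross_const_eq_flip]; exact (crossCLM.flip a).hasFDerivAt
  have hcb : HasFDerivAt (fun y : E3 => cross y b) (crossCLM.flip b) x := by
    rw [cross_const_eq_flip]; exact (crossCLM.flip b).hasFDerivAt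
  have hψb : HasFDerivAt (fun y : E3 => ⟪b, y⟫) (innerSL ℝ b) x := (innerSL ℝ b).hasFDerivAt
  have hψa : HasFDerivAt (fun y : E3 => ⟪a, y⟫) (innerSL ℝ a) x := (innerSL ℝ a).hasFDerivAt
  exact (hψb.smul hca).add (hψa.smul hcb)

/-- **`Φ` is divergence free**: `div Φ = ⟪b, x × a⟫ + ⟪a, x × b⟫ = 0` (the `y`-derivatives of the
linear vector factors are traceless: `⟪v, v × a⟫ = 0`). -/
theorem divergence_toroidalHarmonic (a b x : E3) :
    VectorCalculus.divergence (fun y : E3 => ⟪b, y⟫ • cross y a + ⟪a, y⟫ • cross y b) x = 0 := by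
  set B := EuclideanSpace.basisFun (Fin 3) ℝ with hB
  rw [divergence_eq_sum_inner_fderiv B, (hasFDerivAt_toroidalHarmonic a b x).fderiv]
  have h0 : ∀ v w : E3, ⟪v, cross v w⟫ = 0 := fun v w => by
    simpa only [one_smul] using inner_self_smul_cross v w 1
  have hterm : ∀ i, ⟪B i, ((⟪b, x⟫ • crossCLM.flip a + (innerSL ℝ b).smulRight (cross x a))
      + (⟪a, x⟫ • crossCLM.flip b + (innerSL ℝ a).smulRight (cross x b))) (B i)⟫
      = ⟪b, B i⟫ * ⟪B i, cross x a⟫ + ⟪a, B i⟫ * ⟪B i, cross x b⟫ := by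
    intro i
    simp only [add_apply, smul_apply, ContinuousLinearMap.smulRight_apply,
      ContinuousLinearMap.flip_apply, crossCLM_apply, innerSL_apply_apply, inner_add_right,
      real_inner_smul_right, h0, mul_zero, zero_add]
  simp_rw [hterm, Finset.sum_add_distrib, B.sum_inner_mul_inner, inner_cross_middle_antisymm a b x,
    add_neg_cancel]

/-! ## The radial profile `χ(σ) = σ^{-3/2} + 6 σ^{-5/2}` -/

/-- First derivative of the profile on `σ > 0`. -/
theorem hasDerivAt_chiJ2 {σ : ℝ} (hσ : 0 < σ) :
    HasDerivAt (fun s : ℝ => s ^ (-(3 : ℝ) / 2) + 6 * s ^ (-(5 : ℝ) / 2))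
      (-(3 : ℝ) / 2 * σ ^ (-(3 : ℝ) / 2 - 1) + 6 * (-(5 : ℝ) / 2 * σ ^ (-(5 : ℝ) / 2 - 1))) σ := by
  have h1 := Real.hasDerivAt_rpow_const (x := σ) (p := -(3 : ℝ) / 2) (Or.inl hσ.ne')
  have h2 := (Real.hasDerivAt_rpow_const (x := σ) (p := -(5 : ℝ) / 2) (Or.inl hσ.ne')).const_mul 6
  exact h1.add h2

/-- Second derivative of the profile on `σ > 0`. -/
theorem hasDerivAt_deriv_chiJ2 {σ : ℝ} (hσ : 0 < σ) :
    HasDerivAt (fun s : ℝ => -(3 : ℝ) / 2 * s ^ (-(3 : ℝ) / 2 - 1) + 6 * (-(5 : ℝ) / 2 * s ^ (-(5 : ℝ) / 2 - 1)))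
      (-(3 : ℝ) / 2 * ((-(3 : ℝ) / 2 - 1) * σ ^ (-(3 : ℝ) / 2 - 1 - 1))
        + 6 * (-(5 : ℝ) / 2 * ((-(5 : ℝ) / 2 - 1) * σ ^ (-(5 : ℝ) / 2 - 1 - 1)))) σ := by
  have h1 := (Real.hasDerivAt_rpow_const (x := σ) (p := -(3 : ℝ) / 2 - 1) (Or.inl hσ.ne')).const_mul
    (-(3 : ℝ) / 2)
  have h2 := ((Real.hasDerivAt_rpow_const (x := σ) (p := -(5 : ℝ) / 2 - 1)
    (Or.inl hσ.ne')).const_mul (-(5 : ℝ) / 2)).const_mul 6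
  exact h1.add h2

/-- The profile `y ↦ χ(‖y‖²)` is `C²` off the origin. -/
theorem contDiffAt_chiJ2_comp_norm_sq {x : E3} (hx : x ≠ 0) :
    ContDiffAt ℝ 2 (fun y : E3 => (‖y‖ ^ 2) ^ (-(3 : ℝ) / 2) + 6 * (‖y‖ ^ 2) ^ (-(5 : ℝ) / 2)) x := by
  have hσ : (‖x‖ ^ 2) ≠ 0 := by positivity
  have h : ContDiffAt ℝ 2 (fun y : E3 => ‖y‖ ^ 2) x := (contDiff_norm_sq ℝ (E := E3)).contDiffAt
  exact (h.rpow_const_of_ne hσ).add (contDiffAt_const.mul (h.rpow_const_of_ne hσ))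

/-! ## The zero mode `U(y) = χ(‖y‖²) • Φ(y)` -/

/-- **Laplacian of the zero mode**: `ΔU(x) = −6(‖x‖²)^{−5/2} Φ(x)` for `x ≠ 0`
(`Δχ = 6σ^{−5/2} + 120σ^{−7/2}`, cross term `8χ′ = −12σ^{−5/2} − 120σ^{−7/2}`, `ΔΦ = 0`). -/
theorem laplacian_swirlZeroModeJ2 (a b : E3) {x : E3} (hx : x ≠ 0) :
    (Δ (fun y : E3 => ((‖y‖ ^ 2) ^ (-(3 : ℝ) / 2) + 6 * (‖y‖ ^ 2) ^ (-(5 : ℝ) / 2)) •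
        (⟪b, y⟫ • cross y a + ⟪a, y⟫ • cross y b))) x
      = (-6 * (‖x‖ ^ 2) ^ (-(5 : ℝ) / 2)) • (⟪b, x⟫ • cross x a + ⟪a, x⟫ • cross x b) := by
  have hσ : 0 < ‖x‖ ^ 2 := by positivity
  have hr : ‖x‖ ≠ 0 := norm_ne_zero_iff.mpr hx
  set B := EuclideanSpace.basisFun (Fin 3) ℝ with hB
  set Φ : E3 → E3 := fun y : E3 => ⟪b, y⟫ • cross y a + ⟪a, y⟫ • cross y b with hΦ
  have hφ := contDiffAt_chiJ2_comp_norm_sq hx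
  have hΦ2 : ContDiffAt ℝ 2 Φ x := (contDiff_toroidalHarmonic a b).contDiffAt
  rw [LoewnerNirenberg.laplacian_smul_apply hφ hΦ2 B, laplacian_toroidalHarmonic a b x, smul_zero,
    add_zero]
  -- first derivatives of the radial factor and the cross term
  have hg1 := hasDerivAt_chiJ2 hσ
  have hd1 : ∀ i, fderiv ℝ (fun y : E3 => (‖y‖ ^ 2) ^ (-(3 : ℝ) / 2) + 6 * (‖y‖ ^ 2) ^ (-(5 : ℝ) / 2))
      x (B i) = 2 * (-(3 : ℝ) / 2 * (‖x‖ ^ 2) ^ (-(3 : ℝ) / 2 - 1)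
        + 6 * (-(5 : ℝ) / 2 * (‖x‖ ^ 2) ^ (-(5 : ℝ) / 2 - 1))) * ⟪x, B i⟫ := fun i =>
    fderiv_comp_norm_sq_apply
      (g := fun s : ℝ => s ^ (-(3 : ℝ) / 2) + 6 * s ^ (-(5 : ℝ) / 2)) hg1 (B i)
  have hDΦ : (fderiv ℝ Φ x) x = (2 : ℝ) • Φ x := fderiv_toroidalHarmonic_apply_self a b x
  have hx_repr : ∑ i, ⟪x, B i⟫ • B i = x := by
    conv_rhs => rw [← B.sum_repr' x]
    exact Finset.sum_congr rfl fun i _ => by rw [real_inner_comm]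
  have hsum : ∑ i, (fderiv ℝ (fun y : E3 => (‖y‖ ^ 2) ^ (-(3 : ℝ) / 2) + 6 * (‖y‖ ^ 2) ^ (-(5 : ℝ) / 2))
      x (B i)) • fderiv ℝ Φ x (B i)
      = (2 * (-(3 : ℝ) / 2 * (‖x‖ ^ 2) ^ (-(3 : ℝ) / 2 - 1)
          + 6 * (-(5 : ℝ) / 2 * (‖x‖ ^ 2) ^ (-(5 : ℝ) / 2 - 1))) * 2) • Φ x := by
    calc ∑ i, (fderiv ℝ (fun y : E3 => (‖y‖ ^ 2) ^ (-(3 : ℝ) / 2) + 6 * (‖y‖ ^ 2) ^ (-(5 : ℝ) / 2))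
          x (B i)) • fderiv ℝ Φ x (B i)
        = ∑ i, (2 * (-(3 : ℝ) / 2 * (‖x‖ ^ 2) ^ (-(3 : ℝ) / 2 - 1)
            + 6 * (-(5 : ℝ) / 2 * (‖x‖ ^ 2) ^ (-(5 : ℝ) / 2 - 1)))) • fderiv ℝ Φ x (⟪x, B i⟫ • B i) :=
          Finset.sum_congr rfl fun i _ => by rw [hd1, map_smul, smul_smul]
      _ = (2 * (-(3 : ℝ) / 2 * (‖x‖ ^ 2) ^ (-(3 : ℝ) / 2 - 1)
            + 6 * (-(5 : ℝ) / 2 * (‖x‖ ^ 2) ^ (-(5 : ℝ) / 2 - 1)))) • fderiv ℝ Φ x x := by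
          rw [← Finset.smul_sum, ← map_sum, hx_repr]
      _ = _ := by rw [hDΦ, smul_smul]
  -- the Laplacian of the radial factor (`finrank = 3`)
  have hΔφ : (Δ (fun y : E3 => ((‖y‖ ^ 2) ^ (-(3 : ℝ) / 2) + 6 * (‖y‖ ^ 2) ^ (-(5 : ℝ) / 2) : ℝ))) x
      = 4 * (-(3 : ℝ) / 2 * ((-(3 : ℝ) / 2 - 1) * (‖x‖ ^ 2) ^ (-(3 : ℝ) / 2 - 1 - 1))
          + 6 * (-(5 : ℝ) / 2 * ((-(5 : ℝ) / 2 - 1) * (‖x‖ ^ 2) ^ (-(5 : ℝ) / 2 - 1 - 1)))) * ‖x‖ ^ 2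
        + 2 * (3 : ℕ) * (-(3 : ℝ) / 2 * (‖x‖ ^ 2) ^ (-(3 : ℝ) / 2 - 1)
          + 6 * (-(5 : ℝ) / 2 * (‖x‖ ^ 2) ^ (-(5 : ℝ) / 2 - 1))) := by
    have key := laplacian_comp_norm_sq (E := E3)
      (g := fun s : ℝ => s ^ (-(3 : ℝ) / 2) + 6 * s ^ (-(5 : ℝ) / 2))
      (g₁ := fun s : ℝ => -(3 : ℝ) / 2 * s ^ (-(3 : ℝ) / 2 - 1) + 6 * (-(5 : ℝ) / 2 * s ^ (-(5 : ℝ) / 2 - 1)))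
      isOpen_Ioi (fun s hs => hasDerivAt_chiJ2 hs) (z := x) hσ (hasDerivAt_deriv_chiJ2 hσ)
    rw [key, finrank_euclideanSpace_fin]
  rw [hsum, hΔφ, smul_smul, ← add_smul]
  congr 1
  have e5 : (‖x‖ ^ 2) ^ (-(3 : ℝ) / 2 - 1) = (‖x‖⁻¹) ^ 5 := norm_sq_rpow_eq_inv_pow hx (by norm_num)
  have e7 : (‖x‖ ^ 2) ^ (-(5 : ℝ) / 2 - 1) = (‖x‖⁻¹) ^ 7 := norm_sq_rpow_eq_inv_pow hx (by norm_num)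
  have e7' : (‖x‖ ^ 2) ^ (-(3 : ℝ) / 2 - 1 - 1) = (‖x‖⁻¹) ^ 7 := norm_sq_rpow_eq_inv_pow hx (by norm_num)
  have e9 : (‖x‖ ^ 2) ^ (-(5 : ℝ) / 2 - 1 - 1) = (‖x‖⁻¹) ^ 9 := norm_sq_rpow_eq_inv_pow hx (by norm_num)
  have e5' : (‖x‖ ^ 2) ^ (-(5 : ℝ) / 2) = (‖x‖⁻¹) ^ 5 := norm_sq_rpow_eq_inv_pow hx (by norm_num)
  rw [e5, e7, e7', e9, e5']
  push_cast
  field_simp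
  ring

/-- The zero mode is differentiable off the origin, with `DU(x)[x] = (2σχ′(σ) + 2χ(σ)) Φ(x)
= −((‖x‖²)^{−3/2} + 18(‖x‖²)^{−5/2}) Φ(x)`, `σ = ‖x‖²`. -/
theorem fderiv_swirlZeroModeJ2_apply_self (a b : E3) {x : E3} (hx : x ≠ 0) :
    fderiv ℝ (fun y : E3 => ((‖y‖ ^ 2) ^ (-(3 : ℝ) / 2) + 6 * (‖y‖ ^ 2) ^ (-(5 : ℝ) / 2)) •
        (⟪b, y⟫ • cross y a + ⟪a, y⟫ • cross y b)) x x
      = (-((‖x‖ ^ 2) ^ (-(3 : ℝ) / 2) + 18 * (‖x‖ ^ 2) ^ (-(5 : ℝ) / 2))) •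
        (⟪b, x⟫ • cross x a + ⟪a, x⟫ • cross x b) := by
  have hσ : 0 < ‖x‖ ^ 2 := by positivity
  have hr : ‖x‖ ≠ 0 := norm_ne_zero_iff.mpr hx
  set Φ : E3 → E3 := fun y : E3 => ⟪b, y⟫ • cross y a + ⟪a, y⟫ • cross y b with hΦ
  have hφ := hasFDerivAt_comp_norm_sq (E := E3)
    (g := fun s : ℝ => s ^ (-(3 : ℝ) / 2) + 6 * s ^ (-(5 : ℝ) / 2)) (hasDerivAt_chiJ2 hσ)
  have hΦd : HasFDerivAt Φ (fderiv ℝ Φ x) x :=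
    ((contDiff_toroidalHarmonic a b (n := 1)).differentiable one_ne_zero).differentiableAt.hasFDerivAt
  have hU : HasFDerivAt (fun y : E3 => ((‖y‖ ^ 2) ^ (-(3 : ℝ) / 2) + 6 * (‖y‖ ^ 2) ^ (-(5 : ℝ) / 2)) •
      (⟪b, y⟫ • cross y a + ⟪a, y⟫ • cross y b))
      (((‖x‖ ^ 2) ^ (-(3 : ℝ) / 2) + 6 * (‖x‖ ^ 2) ^ (-(5 : ℝ) / 2)) • fderiv ℝ Φ x
        + ((2 * (-(3 : ℝ) / 2 * (‖x‖ ^ 2) ^ (-(3 : ℝ) / 2 - 1)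
            + 6 * (-(5 : ℝ) / 2 * (‖x‖ ^ 2) ^ (-(5 : ℝ) / 2 - 1)))) • (innerSL ℝ x : E3 →L[ℝ] ℝ)).smulRight
          (Φ x)) x :=
    hφ.smul hΦd
  rw [hU.fderiv]
  simp only [add_apply, smul_apply, ContinuousLinearMap.smulRight_apply, innerSL_apply_apply,
    real_inner_self_eq_norm_sq]
  rw [show (fderiv ℝ Φ x) x = (2 : ℝ) • Φ x from fderiv_toroidalHarmonic_apply_self a b x, smul_smul,
    ← add_smul]
  congr 1
  have e3 : (‖x‖ ^ 2) ^ (-(3 : ℝ) / 2) = (‖x‖⁻¹) ^ 3 := norm_sq_rpow_eq_inv_pow hx (by norm_num)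
  have e5 : (‖x‖ ^ 2) ^ (-(3 : ℝ) / 2 - 1) = (‖x‖⁻¹) ^ 5 := norm_sq_rpow_eq_inv_pow hx (by norm_num)
  have e5' : (‖x‖ ^ 2) ^ (-(5 : ℝ) / 2) = (‖x‖⁻¹) ^ 5 := norm_sq_rpow_eq_inv_pow hx (by norm_num)
  have e7 : (‖x‖ ^ 2) ^ (-(5 : ℝ) / 2 - 1) = (‖x‖⁻¹) ^ 7 := norm_sq_rpow_eq_inv_pow hx (by norm_num)
  rw [e3, e5, e5', e7]
  have hu : ‖x‖⁻¹ * ‖x‖ = 1 := inv_mul_cancel₀ hr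
  have h1 : (‖x‖⁻¹) ^ 5 * ‖x‖ ^ 2 = (‖x‖⁻¹) ^ 3 := by
    calc (‖x‖⁻¹) ^ 5 * ‖x‖ ^ 2 = (‖x‖⁻¹) ^ 3 * (‖x‖⁻¹ * ‖x‖) ^ 2 := by ring
      _ = (‖x‖⁻¹) ^ 3 := by rw [hu]; ring
  have h2 : (‖x‖⁻¹) ^ 7 * ‖x‖ ^ 2 = (‖x‖⁻¹) ^ 5 := by
    calc (‖x‖⁻¹) ^ 7 * ‖x‖ ^ 2 = (‖x‖⁻¹) ^ 5 * (‖x‖⁻¹ * ‖x‖) ^ 2 := by ring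
      _ = (‖x‖⁻¹) ^ 5 := by rw [hu]; ring
  linear_combination (-3 : ℝ) * h1 + (-30 : ℝ) * h2

/-- ★★ **An elementary EXACT zero mode of the linearised Leray profile operator in the swirl sector
`J = 2`**: for every `a b : ℝ³` and `x ≠ 0`, the toroidal Type-I field
`U(y) = ((‖y‖²)^{−3/2} + 6(‖y‖²)^{−5/2}) • (⟪b,y⟫(y × a) + ⟪a,y⟫(y × b))`
(`= (|y|⁻³ + 6|y|⁻⁵)(y × ∇(⟪a,y⟫⟪b,y⟫))`) satisfies
`−ΔU(x) + ½U(x) + ½DU(x)[x] = 0` — the profile equation of `IsLerayProfile 1 ½` (NRŠ (1.4)) with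
ZERO pressure and without the convective term, exactly on `ℝ³ ∖ {0}`.  DATUM B-2m FACT 1
(ns-wall-eng-2 g2; crit-1 (i)) in its terminating (even-`J`) instance: swirl sectors DO have
zero-residual decaying exteriors once the `J(J+1)|y|⁻³ = 6|y|⁻⁵`-companion is added. -/
theorem swirlZeroModeJ2_linearisedLerayProfile (a b : E3) {x : E3} (hx : x ≠ 0) :
    -((Δ (fun y : E3 => ((‖y‖ ^ 2) ^ (-(3 : ℝ) / 2) + 6 * (‖y‖ ^ 2) ^ (-(5 : ℝ) / 2)) •
          (⟪b, y⟫ • cross y a + ⟪a, y⟫ • cross y b))) x)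
      + (1 / 2 : ℝ) • (((‖x‖ ^ 2) ^ (-(3 : ℝ) / 2) + 6 * (‖x‖ ^ 2) ^ (-(5 : ℝ) / 2)) •
          (⟪b, x⟫ • cross x a + ⟪a, x⟫ • cross x b))
      + (1 / 2 : ℝ) • fderiv ℝ (fun y : E3 => ((‖y‖ ^ 2) ^ (-(3 : ℝ) / 2) + 6 * (‖y‖ ^ 2) ^ (-(5 : ℝ) / 2)) •
          (⟪b, y⟫ • cross y a + ⟪a, y⟫ • cross y b)) x x = 0 := by
  rw [laplacian_swirlZeroModeJ2 a b hx, fderiv_swirlZeroModeJ2_apply_self a b hx, smul_smul, smul_smul,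
    ← neg_smul, ← add_smul, ← add_smul]
  have h0 : -(-6 * (‖x‖ ^ 2) ^ (-(5 : ℝ) / 2))
      + 1 / 2 * ((‖x‖ ^ 2) ^ (-(3 : ℝ) / 2) + 6 * (‖x‖ ^ 2) ^ (-(5 : ℝ) / 2))
      + 1 / 2 * -((‖x‖ ^ 2) ^ (-(3 : ℝ) / 2) + 18 * (‖x‖ ^ 2) ^ (-(5 : ℝ) / 2)) = 0 := by ring
  rw [h0, zero_smul]

/-- **The zero mode is divergence free** off the origin:
`div U = 2χ′(‖x‖²)⟪x, Φ(x)⟫ + χ(‖x‖²) div Φ(x) = 0`. -/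
theorem divergence_swirlZeroModeJ2_eq_zero (a b : E3) {x : E3} (hx : x ≠ 0) :
    VectorCalculus.divergence (fun y : E3 => ((‖y‖ ^ 2) ^ (-(3 : ℝ) / 2) + 6 * (‖y‖ ^ 2) ^ (-(5 : ℝ) / 2)) •
        (⟪b, y⟫ • cross y a + ⟪a, y⟫ • cross y b)) x = 0 := by
  have hσ : 0 < ‖x‖ ^ 2 := by positivity
  set B := EuclideanSpace.basisFun (Fin 3) ℝ with hB
  set Φ : E3 → E3 := fun y : E3 => ⟪b, y⟫ • cross y a + ⟪a, y⟫ • cross y b with hΦ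
  have hφ := hasFDerivAt_comp_norm_sq (E := E3)
    (g := fun s : ℝ => s ^ (-(3 : ℝ) / 2) + 6 * s ^ (-(5 : ℝ) / 2)) (hasDerivAt_chiJ2 hσ)
  have hΦd : HasFDerivAt Φ (fderiv ℝ Φ x) x :=
    ((contDiff_toroidalHarmonic a b (n := 1)).differentiable one_ne_zero).differentiableAt.hasFDerivAt
  have hdivΦ : ∑ i, ⟪B i, fderiv ℝ Φ x (B i)⟫ = 0 := by
    rw [← divergence_eq_sum_inner_fderiv B]; exact divergence_toroidalHarmonic a b x
  have hxΦ : ⟪x, Φ x⟫ = 0 := inner_self_toroidalHarmonic a b x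
  have hU : HasFDerivAt (fun y : E3 => ((‖y‖ ^ 2) ^ (-(3 : ℝ) / 2) + 6 * (‖y‖ ^ 2) ^ (-(5 : ℝ) / 2)) •
      (⟪b, y⟫ • cross y a + ⟪a, y⟫ • cross y b))
      (((‖x‖ ^ 2) ^ (-(3 : ℝ) / 2) + 6 * (‖x‖ ^ 2) ^ (-(5 : ℝ) / 2)) • fderiv ℝ Φ x
        + ((2 * (-(3 : ℝ) / 2 * (‖x‖ ^ 2) ^ (-(3 : ℝ) / 2 - 1)
            + 6 * (-(5 : ℝ) / 2 * (‖x‖ ^ 2) ^ (-(5 : ℝ) / 2 - 1)))) • (innerSL ℝ x : E3 →L[ℝ] ℝ)).smulRight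
          (Φ x)) x :=
    hφ.smul hΦd
  rw [divergence_eq_sum_inner_fderiv B, hU.fderiv]
  have hterm : ∀ i, ⟪B i, ((((‖x‖ ^ 2) ^ (-(3 : ℝ) / 2) + 6 * (‖x‖ ^ 2) ^ (-(5 : ℝ) / 2)) • fderiv ℝ Φ x
      + ((2 * (-(3 : ℝ) / 2 * (‖x‖ ^ 2) ^ (-(3 : ℝ) / 2 - 1)
          + 6 * (-(5 : ℝ) / 2 * (‖x‖ ^ 2) ^ (-(5 : ℝ) / 2 - 1)))) • (innerSL ℝ x : E3 →L[ℝ] ℝ)).smulRight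
        (Φ x))) (B i)⟫
      = ((‖x‖ ^ 2) ^ (-(3 : ℝ) / 2) + 6 * (‖x‖ ^ 2) ^ (-(5 : ℝ) / 2)) * ⟪B i, fderiv ℝ Φ x (B i)⟫
        + (2 * (-(3 : ℝ) / 2 * (‖x‖ ^ 2) ^ (-(3 : ℝ) / 2 - 1)
          + 6 * (-(5 : ℝ) / 2 * (‖x‖ ^ 2) ^ (-(5 : ℝ) / 2 - 1)))) * (⟪x, B i⟫ * ⟪B i, Φ x⟫) := by
    intro i
    simp only [add_apply, smul_apply, ContinuousLinearMap.smulRight_apply, innerSL_apply_apply,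
      inner_add_right, real_inner_smul_right, smul_eq_mul]
    ring
  simp_rw [hterm, Finset.sum_add_distrib, ← Finset.mul_sum, hdivΦ, B.sum_inner_mul_inner, hxΦ,
    mul_zero, add_zero]

end SwirlTail

end Summit.NavierStokesRegularity.NavierStokesRegularity.Cruxes.ScarEnvelopeTypeI.ForcedTsai

end
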